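import Mathlib
import Summits.NavierStokesRegularity.NavierStokesRegularity.Theses.EulerZoomLiouville
import Summits.NavierStokesRegularity.NavierStokesRegularity.Theorems.EulerZoomLiouvillePowerGaugeEulerLiouvilleLargeRho
import Summits.NavierStokesRegularity.NavierStokesRegularity.Theorems.EulerZoomLiouvillePowerGaugeEulerLiouvilleWindowFluxBoundsSplit
import Summits.NavierStokesRegularity.NavierStokesRegularity.Theorems.EulerZoomLiouvillePowerGaugeEulerLiouvilleWindowIdentity
import Summits.NavierStokesRegularity.NavierStokesRegularity.Theorems.EulerZoomLiouvillePowerGaugeEulerLiouvilleExtinctIdentity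
import HarnessLib.Audit

/-!
# Line `extinct-trace` (ideator ns-idea-11 g5, lens «complete» = program-completion) for the crux
# `EulerZoomLiouville.PowerGaugeEulerLiouville` (stmt-NavierStokesRegularity-19832)

PROGRAMME COMPLETED.  Seregin's own Euler-side argument in arXiv:2507.08733 (2025), §2 (pp. 4–6): in the first-singularity
scenario the Euler zoom limit `(u,p)` satisfies the LOCAL ENERGY IDENTITY (equality, p. 5: "we can take the limit … and get
the local energy identity for the Euler equations"), its FINAL TRACE `u(·,0)` is the critical zoom of the FIXED slice `v(·,0)`,
hence vanishes as soon as that slice does not concentrate at the critical rate (p. 4: the `L_{s₂,l₂}` hypothesis (1.10)–(1.11)),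
and then the identity between a time `s < 0` and the final time, `∫|u(s)|²φ_a = ∫_s^0 ∫ (|u|²+2p) u·∇φ_a` (p. 5, (2.6)), kills `u`
once the flux through the final window is `o(a)` — which Seregin gets from the extra Lebesgue class `u ∈ L_∞(L_{3/α})` and
ONLY for `1 < α < 3/2`, i.e. `0 < ρ < 1/2` ("it is assumed that 1 > m > 1/2", p. 4: the endpoint `ρ = 1/2` is left out).
AUTHOR-NAMED GAPS this line types: (G1) the Lebesgue hypothesis (1.10) itself — here REPLACED, on the Euler side, by the two
structural properties the argument actually consumes: «conservative» (local energy equality) and «extinct» (no energy survives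
to the final time at any fixed scale); (G2) the flux through the FINAL window `(s,0) × B_a` is `o(a)` from the GAUGES ALONE when
`2/9 < ρ` — this is the tree's LANDED one-ball bound `exists_oneBall_window_le_split` (lead, `…WindowFluxBoundsSplit`, which
allows `β = 0`), so the endpoint `ρ = 1/2` IS covered here; (G3) the window `0 < ρ ≤ 2/9`, named by the lead's
`…WindowFluxTwoNinths` ("the window (0, 2/9] is what remains for these strata") and by Seregin's need for (1.10).

THE STRATUM `IsExtinctConservative`: members of the crux's class (weak! no classical hypothesis, no velocity/gradient envelope,
no symmetry) that (i) satisfy the local energy EQUALITY on `(−∞,0) × ℝ³` and (ii) are ENERGY-EXTINCT at the final time: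
`∫_{B_a} |u(τ)|² → 0` as `τ → 0⁻` for every fixed `a`.  STRATUM THEOREM (X2 `stub_extinctIdentity`, M): for `2/9 < ρ ≤ 1/2` such a
member is trivial — localise the identity to `η(t)χ_a(x)`, pass `η → 1_{(s,σ)}` at Lebesgue points, let `σ → 0⁻` (extinction), bound
the remaining final-window flux by (G2) `≤ C M a^{1/2 − 9ρ/4} → 0`, and exhaust `a = 2ⁿ → ∞` by monotone convergence: `∫|u(s)|² = 0`
for a.e. `s`.  It is the TIME-MIRROR of the lead's «no Euler collapse from rest» (`powerGaugeEulerLiouville_fromRest_twoNinths`,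
energy absent at `t = −∞`): «no CONSERVATIVE Euler collapse INTO rest» (energy absent at `t = 0⁻`) — and the mirror needs the
equality, because the inequality lets the energy at time `s` be dissipated anomalously before the final time.

WHY THE ROUTE CARES (dictionary, NS side — a remark for the lead/director, not a stub of this crux): by Seregin 2025 pp. 4–5 a
first-singularity zoom limit is ALWAYS conservative, and it is extinct iff the blow-up does NOT concentrate `L²`-energy at the
critical rate in thin final cylinders, `lim_{δ→0} limsup_{r→0} sup_{−δ r^{2+ρ} < t < 0} r^{2ρ−1} ∫_{B_r} |v(t)|² = 0` (implied by
Seregin's (1.10) with `l₂ = ∞` by Hölder; at `ρ = 1/2` it reads «no L²-ATOM forms at the singular point», the Navier–Stokes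
form of Chae–Wolf arXiv:1706.02020 Thm 1.1).  So modulo X2 the Type II scenario (1.7) of arXiv:2507.08733 / (1.2) of
arXiv:2606.29468 with `2/9 < ρ ≤ 1/2` FORCES critical energy concentration — Theorem 1.1 of arXiv:2507.08733 with its hypothesis
(1.10) weakened and its excluded endpoint `m = 1/2` included.

RESIDUES (OPEN, not claimed): X3 `stub_extinctSmallRho` — the same stratum on `0 < ρ ≤ 2/9` (needs a final-window flux bound
beyond the cubic rate `a^{3/2−9ρ/4}`; shared with the lead's (0,2/9] window); X4a `stub_dissipativeRest` — members violating the
energy equality (irrelevant for the NS route by the dictionary above, open for the crux as typed: a candidate ROUTE EDIT is to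
add conservativity to the class of 19832); X4b `stub_persistentRest` — conservative members whose energy PERSISTS at the final
time at some fixed scale: this contains every self-similar / DSS candidate of the Chae–Shvydkoy window (their extremal static
tail `|y|^{−1−ρ}Θ` has `∫_{B_a}|u(τ)|² → κ a^{1−2ρ} > 0`) and is the open core, untouched.

REV2 (ideator ns-idea-11 g6, 2026-08-28 — width bookkeeping + the author's own theorem typed):
(a) X2's FIRST STEP IS NOW A TREE FACT: the exact window identity of conservative members, `E_χ(σ) − E_χ(s) = ∫_s^σ∫(|u|²+2p)u·∇χ`
    for a.e. `s < σ < 0`, is ns-ezl-w6 g2's p645814 `WindowIdentity.hasWindowIdentity_of_isEnergyConservative` (O2 of line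
    `lions_gate`; predicate bodies verbatim = this file's `IsEnergyConservative` / `HasWindowIdentity`) — wired here as the checked
    lemma `hasWindowIdentity_of_conservative`.  What remains of X2 is S/M: `σ → 0⁻` outside the null time set by extinction,
    dominated convergence of the window flux (integrable by (G2)), the cutoff exhaustion `a = 2ⁿ → ∞` for `2/9 < ρ`, Beppo Levi.
    (And by ns-ezl-w1 g4's p648026 `LionsGate.isEnergyConservative_of_memL4Loc`, O1 of `lions_gate`, every `L⁴_loc` member IS
    conservative: the extinct `L⁴_loc` members are inside the stratum.)
(b) THE AUTHOR'S THEOREM, TYPED (gap (G1) in its original form, as a PORT target inside the residue window): X3s `stub_extinctSerrin` —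
    for ALL `0 < ρ < 1/2`, an extinct conservative member with Seregin's extra Lebesgue class `u ∈ L_∞(−∞,0; L_{3/(1+ρ)}(ℝ³))`
    (`MemSerrin ρ u`, his `‖u‖_{3/α,∞,Q_−} < ∞`, (additional-est) p. 4) is trivial: arXiv:2507.08733 pp. 5–6 VERBATIM — cubic flux
    `(1/a)∫∫_{B_{2a}}|u|³ ≲ a^{3(2−α)(α−1)/(2α−1) − 1} → 0` by interpolation `L^{3/α} ∩ Ḣ¹` + the E/A-gauges; pressure `p = p₁ + p₂`,
    `p₁ = −|u|²/3 + K ∗ (u⊗u)` split as `p₁₁ + p₁₂ + c₀(t)` on `B_{2a}` (Calderón–Zygmund + far-field tails `≲ ‖u‖²_{3/α} a^{−2α}`),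
    `p₂` harmonic and ZERO by the D-gauge growth `a^{2m}`, `2m ≥ 1`, and the mean-value Liouville argument for `g(x₀) = ∫_a^b p₂(x₀,t)dt`;
    hence `∫|u(s)|²φ_a → 0`.  The residue X3 is re-cut as X3r `stub_extinctSmallRhoRest` (`0 < ρ ≤ 2/9`, NOT in Seregin's class);
    the checked lemma `stub_extinctSmallRho_of` shows X3s + X3r refine the old X3.

REV3 (width): X2 `stub_extinctIdentity` is a TREE THEOREM — ns-ezl-w1 g4 p649850 `…Theorems.PowerGaugeEulerLiouville.ExtinctTrace.extinctIdentity`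
(bodies verbatim) — wired term-mode; the skeleton's sorries are now exactly X3s (PORT), X3r, X4a, X4b.

No summit is proved by a line: this file is a skeleton (stubs X2, X3s, X3r, X4a, X4b are `sorry`); its kernel-checked content is
the composition `PowerGaugeEulerLiouville_of`, the by-name wiring of (G2) to the lead's landed theorem, the by-name wiring of the
window identity (`hasWindowIdentity_of_conservative`) and the refinement lemma `stub_extinctSmallRho_of`.
-/

noncomputable section

set_option linter.dupNamespace false

open MeasureTheory Set Filter Topology Metric Real
open scoped ENNReal NNReal RealInnerProductSpace
open Literature.Analysis Literature.Analysis.FluidPDE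

namespace Summit.NavierStokesRegularity.NavierStokesRegularity.Cruxes.PowerGaugeEulerLiouville.ExtinctTrace

/-- Local abbreviation: ℝ³. -/
abbrev E3 : Type := EuclideanSpace ℝ (Fin 3)

/-- Membership in Seregin's power-gauged ancient Euler class — verbatim the three hypotheses of the crux (same as `Birth.InClass`). -/
@[reducible] def InClass (ρ : ℝ) (u : ℝ → E3 → E3) (p : ℝ → E3 → ℝ) (H : ℝ → E3 → E3 →L[ℝ] E3)
    (c : ℝ≥0) : Prop :=
  IsSuitableWeakSolutionOn (slab (EuclideanSpace ℝ (Fin 3)) (Set.Iio 0) isOpen_Iio) 0 0 u p ∧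
    HasWeakSpatialGradientOn (slab (EuclideanSpace ℝ (Fin 3)) (Set.Iio 0) isOpen_Iio) u H ∧
    (∀ a : ℝ, 0 < a →
      ENNReal.ofReal (a ^ (2 * ρ)) * cknA a (0 : ℝ × E3) u + ENNReal.ofReal (a ^ ρ) * cknE a (0 : ℝ × E3) H +
        ENNReal.ofReal (a ^ (2 * ρ)) * cknD a (0 : ℝ × E3) p ≤ (c : ℝ≥0∞))

/-- The conclusion of the crux: `u` vanishes a.e. on the past slab. -/
@[reducible] def VanishesAE (u : ℝ → E3 → E3) : Prop :=
  Function.uncurry u =ᵐ[volume.restrict (Set.Iio (0 : ℝ) ×ˢ (Set.univ : Set E3))] 0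

/-! ## The stratum: conservative, energy-extinct members -/

/-- **Conservative member**: the local energy EQUALITY of Euler on the past slab — for every space–time test function `φ`
supported in `(−∞,0) × ℝ³` (no sign condition), `∫∫ (|u|² ∂ₜφ + (|u|² + 2p) u·∇φ) = 0`.  This is the `ν = 0`, `f = 0` case of the
local energy inequality of `IsSuitableWeakSolutionOn` (CKN (2.5)) with `≤` replaced by `=`, in the same iterated-integral form;
Seregin arXiv:2507.08733 p. 5 ("local energy identity for the Euler equations") shows first-singularity zoom limits have it. -/
def IsEnergyConservative (u : ℝ → E3 → E3) (p : ℝ → E3 → ℝ) : Prop :=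
  ∀ φ : ℝ → E3 → ℝ, IsSpaceTimeTestOn (slab (EuclideanSpace ℝ (Fin 3)) (Set.Iio 0) isOpen_Iio) φ →
    ∫ t, ∫ x, (‖u t x‖ ^ 2 * timeDeriv φ t x + (‖u t x‖ ^ 2 + 2 * p t x) * ⟪u t x, gradient (φ t) x⟫) = 0

/-- **Energy-extinct member**: no energy survives to the final time at any fixed scale — for every radius `a`,
`∫_{B_a} |u(τ,x)|² dx → 0` as `τ → 0⁻` (lower Lebesgue integral: no junk values; a representative-level hypothesis which implies
the essential one used in proofs).  Self-similar candidates are NOT extinct (static extremal tail: the limit is `κ a^{1−2ρ} > 0`). -/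
def IsEnergyExtinct (u : ℝ → E3 → E3) : Prop :=
  ∀ a : ℝ, 0 < a →
    Tendsto (fun τ : ℝ => ∫⁻ x in Metric.ball (0 : E3) a, ‖u τ x‖ₑ ^ 2) (𝓝[<] (0 : ℝ)) (𝓝 0)

/-- The stratum of this line: conservative AND energy-extinct. -/
def IsExtinctConservative (u : ℝ → E3 → E3) (p : ℝ → E3 → ℝ) : Prop :=
  IsEnergyConservative u p ∧ IsEnergyExtinct u

/-- **Exact window identity** (verbatim the predicate of line `lions_gate` / tree `…WindowIdentity`): for every smooth compactly
supported spatial cutoff `χ` there is a null set of times outside which, for all `s < σ < 0`,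
`∫ χ|u(σ)|² − ∫ χ|u(s)|² = ∫_s^σ ∫ (|u|² + 2p) ⟪u, ∇χ⟫`. -/
def HasWindowIdentity (u : ℝ → E3 → E3) (p : ℝ → E3 → ℝ) : Prop :=
  ∀ χ : E3 → ℝ, ContDiff ℝ (⊤ : ℕ∞) χ → HasCompactSupport χ →
    ∃ N : Set ℝ, volume N = 0 ∧ ∀ s σ : ℝ, s < σ → σ < 0 → s ∉ N → σ ∉ N →
      (∫ x, χ x * ‖u σ x‖ ^ 2) - (∫ x, χ x * ‖u s x‖ ^ 2) =
        ∫ τ in Set.Ioo s σ, ∫ x, (‖u τ x‖ ^ 2 + 2 * p τ x) * ⟪u τ x, gradient χ x⟫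

/-- **Seregin's extra Lebesgue class on the Euler side** (arXiv:2507.08733 (additional-est), p. 4: `‖u‖_{3/α,∞,Q_−} ≤ ‖v‖_{3/α,∞,Q}`,
`α = 1 + ρ`): `u ∈ L_∞(−∞,0; L_{3/(1+ρ)}(ℝ³))` — GLOBAL in space, essentially bounded in time.  Lower Lebesgue integral with a real
exponent: junk-free.  For `0 < ρ < 1/2` the exponent `3/(1+ρ) ∈ (2,3)` is supercritical for the similarity tail `|y|^{−1−ρ}`
(`∫^∞ r^{−3} r² dr` diverges only logarithmically at `ρ`-independent order: the extremal tail is NOT in the class), so the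
self-similar candidates are outside this stratum, as they must be. -/
def MemSerrin (ρ : ℝ) (u : ℝ → E3 → E3) : Prop :=
  ∃ N : ℝ≥0, ∀ᵐ τ ∂(volume.restrict (Set.Iio (0 : ℝ))), ∫⁻ x, ‖u τ x‖ₑ ^ (3 / (1 + ρ) : ℝ) ≤ (N : ℝ≥0∞)

/-- **Final-window flux bound at the cubic rate** (the shape of the lead's landed `exists_oneBall_window_le_split` with `β = 0`):
for every `s < 0` there is `M ≥ 0` with `∫_{(s,0) × B_a} (|u|³ + 2|p||u|) ≤ M a^{3/2 − 9ρ/4}` for all `a ≥ 1` with `−a² ≤ s`.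
Divided by the cutoff gradient `~ 1/a` this is `O(a^{1/2 − 9ρ/4}) → 0` exactly when `2/9 < ρ`. -/
def HasFinalWindowFluxBound (ρ : ℝ) (u : ℝ → E3 → E3) (p : ℝ → E3 → ℝ) : Prop :=
  ∀ s : ℝ, s < 0 → ∃ M : ℝ, 0 ≤ M ∧ ∀ a : ℝ, 1 ≤ a → -(a ^ 2) ≤ s →
    ∫⁻ z in Set.Ioo s 0 ×ˢ Metric.ball (0 : E3) a,
        (‖u z.1 z.2‖ₑ ^ (3 : ℕ) + 2 * (‖p z.1 z.2‖ₑ * ‖u z.1 z.2‖ₑ)) ≤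
      ENNReal.ofReal (M * a ^ (3 / 2 - 9 * ρ / 4))

/-- **(G2) LANDED, by name**: every member (any `0 ≤ ρ`) has the final-window flux bound — the lead's
`exists_oneBall_window_le_split` (`…WindowFluxBoundsSplit`, pressure splitting + Calderón–Zygmund, windows `(α,β]` with `β ≤ 0`)
applied with `α = s`, `β = 0`.  No sorry. -/
theorem hasFinalWindowFluxBound_of_inClass {ρ : ℝ} (hρ : 0 ≤ ρ) {u : ℝ → E3 → E3} {p : ℝ → E3 → ℝ}
    {H : ℝ → E3 → E3 →L[ℝ] E3} {c : ℝ≥0} (h : InClass ρ u p H c) : HasFinalWindowFluxBound ρ u p :=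
  fun _s hs =>
    Summit.NavierStokesRegularity.NavierStokesRegularity.Theorems.PowerGaugeEulerLiouville.exists_oneBall_window_le_split
      hρ h.1 h.2.1 h.2.2 hs le_rfl

/-- **REV2 — X2's first step, BY NAME**: a conservative member of the class has the exact window identity (ns-ezl-w6 g2, p645814
`WindowIdentity.hasWindowIdentity_of_isEnergyConservative`; of the class only suitability and the E-gauge are used).  No sorry. -/
theorem hasWindowIdentity_of_conservative {ρ : ℝ} {u : ℝ → E3 → E3} {p : ℝ → E3 → ℝ}
    {H : ℝ → E3 → E3 →L[ℝ] E3} {c : ℝ≥0} (h : InClass ρ u p H c) (hC : IsEnergyConservative u p) :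
    HasWindowIdentity u p :=
  Summit.NavierStokesRegularity.NavierStokesRegularity.Theorems.PowerGaugeEulerLiouville.WindowIdentity.hasWindowIdentity_of_isEnergyConservative
    h hC

/-! ## Registered stub signatures -/

/-- X2 (M, the stratum theorem): for `2/9 < ρ ≤ 1/2`, a conservative energy-extinct member with the final-window flux bound is
trivial.  Proof plan: test functions `η(t)χ_a(x)` (`χ_a = 1` on `B_a`, supported in `B_{2a}`, `|∇χ_a| ≤ 2/a`) in the energy
EQUALITY; `η → 1_{(s,σ)}` at Lebesgue points of `t ↦ ∫|u(t)|²χ_a` gives `E_{χ_a}(σ) − E_{χ_a}(s) = ∫_s^σ∫(|u|²+2p)u·∇χ_a`;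
`σ → 0⁻` by extinction (`E_{χ_a}(σ) ≤ ∫_{B_{2a}}|u(σ)|² → 0`) and dominated convergence (the flux density is integrable on
`(s,0) × B_{2a}` by the bound); hence `∫_{B_a}|u(s)|² ≤ E_{χ_a}(s) ≤ (2/a) M (2a)^{3/2−9ρ/4} → 0` along `a = 2ⁿ`, and monotone
convergence in `a` gives `∫|u(s)|² = 0` for a.e. `s < 0`. -/
def Sig.stub_extinctIdentity : Prop :=
  ∀ ρ : ℝ, 2 / 9 < ρ → ρ ≤ 1 / 2 → ∀ (u : ℝ → E3 → E3) (p : ℝ → E3 → ℝ) (H : ℝ → E3 → E3 →L[ℝ] E3) (c : ℝ≥0),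
    InClass ρ u p H c → HasFinalWindowFluxBound ρ u p → IsExtinctConservative u p → VanishesAE u

/-- Old X3 (rev1; kept as a DEFINITION only — re-cut in rev2 into X3s + X3r, see `stub_extinctSmallRho_of`): the stratum on the
window `0 < ρ ≤ 2/9`, where the cubic rate `a^{3/2−9ρ/4}` no longer beats the cutoff gradient `1/a`. -/
def Sig.stub_extinctSmallRho : Prop :=
  ∀ ρ : ℝ, 0 < ρ → ρ ≤ 2 / 9 → ∀ (u : ℝ → E3 → E3) (p : ℝ → E3 → ℝ) (H : ℝ → E3 → E3 →L[ℝ] E3) (c : ℝ≥0),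
    InClass ρ u p H c → IsExtinctConservative u p → VanishesAE u

/-- X3s (REV2 — PORT, M/L: THE AUTHOR'S OWN THEOREM, Euler half of arXiv:2507.08733 Thm 1.1, pp. 5–6 verbatim): for every
`0 < ρ < 1/2`, an extinct conservative member of the class lying in Seregin's extra Lebesgue class `L_∞(L_{3/(1+ρ)})` is trivial.
Inputs, all in the hypotheses: the window identity (`hasWindowIdentity_of_conservative`) pushed to `σ → 0⁻` by extinction; the
A/E-gauges for the cubic flux via the interpolation `‖u‖³_{L³(B_a)} ≤ ‖u‖^{6α/(2α−1)}_{L^{3/α}} ‖u‖^{6(α−1)/(2α−1)}_{L⁶}` and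
Gagliardo–Nirenberg on balls (exponent `3(2−α)(α−1)/(2α−1) < 1`); the D-gauge (`2m = 2 − 2ρ ≥ 1`) and harmonic Liouville for the
`p₂` part of the pressure split `p = p₁ + p₂`, `p₁ = −|u|²/3 + K ∗ (u ⊗ u)` (Calderón–Zygmund; far tails `≲ ‖u‖²_{3/α} a^{−2α}`,
`a^{−1−2α}`); Beppo Levi in `a`.  Why it might fail: only in the port (the tree's CZ/pressure-splitting kit is the lead's
`…WindowFluxBoundsSplit`; the global-in-space singular integral needs `u(t) ∈ L^{3/α}(ℝ³)`, which is exactly `MemSerrin`). -/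
def Sig.stub_extinctSerrin : Prop :=
  ∀ ρ : ℝ, 0 < ρ → ρ < 1 / 2 → ∀ (u : ℝ → E3 → E3) (p : ℝ → E3 → ℝ) (H : ℝ → E3 → E3 →L[ℝ] E3) (c : ℝ≥0),
    InClass ρ u p H c → IsExtinctConservative u p → MemSerrin ρ u → VanishesAE u

/-- X3r (OPEN residue of the window, not claimed; author-named gap (G3) proper): extinct conservative members with `0 < ρ ≤ 2/9`
OUTSIDE Seregin's Lebesgue class.  Needs a final-window flux bound beyond the cubic rate `a^{3/2−9ρ/4}` without (1.10); shared with
the lead's `(0, 2/9]` window (`…WindowFluxTwoNinths`). -/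
def Sig.stub_extinctSmallRhoRest : Prop :=
  ∀ ρ : ℝ, 0 < ρ → ρ ≤ 2 / 9 → ∀ (u : ℝ → E3 → E3) (p : ℝ → E3 → ℝ) (H : ℝ → E3 → E3 →L[ℝ] E3) (c : ℝ≥0),
    InClass ρ u p H c → IsExtinctConservative u p → ¬ MemSerrin ρ u → VanishesAE u

/-- X4a (OPEN residue, not claimed): members violating the local energy EQUALITY (strictly dissipative somewhere) are trivial.
Irrelevant for the Navier–Stokes route (first-singularity zoom limits are conservative, arXiv:2507.08733 p. 5) — recorded as a
candidate route edit (add conservativity to the class) — but open for the crux as typed. -/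
def Sig.stub_dissipativeRest : Prop :=
  ∀ ρ : ℝ, 0 < ρ → ρ ≤ 1 / 2 → ∀ (u : ℝ → E3 → E3) (p : ℝ → E3 → ℝ) (H : ℝ → E3 → E3 →L[ℝ] E3) (c : ℝ≥0),
    InClass ρ u p H c → ¬ IsEnergyConservative u p → VanishesAE u

/-- X4b (OPEN residue = the core, not claimed): conservative members whose energy PERSISTS at the final time at some fixed scale
(`¬ IsEnergyExtinct`) are trivial.  Contains every self-similar / DSS candidate of the Chae–Shvydkoy window. -/
def Sig.stub_persistentRest : Prop :=
  ∀ ρ : ℝ, 0 < ρ → ρ ≤ 1 / 2 → ∀ (u : ℝ → E3 → E3) (p : ℝ → E3 → ℝ) (H : ℝ → E3 → E3 →L[ℝ] E3) (c : ℝ≥0),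
    InClass ρ u p H c → IsEnergyConservative u p → ¬ IsEnergyExtinct u → VanishesAE u

/-! ## Stubs -/

/-- STUB X2 [OPEN, S/M since rev2 — the stratum theorem FOR `2/9 < ρ ≤ 1/2` ONLY; analytic inputs are the landed (G2)
`hasFinalWindowFluxBound_of_inClass` and the landed window identity `hasWindowIdentity_of_conservative`; what remains is `σ → 0⁻` by
extinction + cutoff exhaustion.  NOTE (critic N64): X2 ∪ X3s do NOT cover the extinct conservative stratum on `(0, 2/9]` outside
`MemSerrin` — that is exactly the open residue X3r]. -/
theorem stub_extinctIdentity : Sig.stub_extinctIdentity :=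
  -- X2 LANDED BY NAME (rev3): ns-ezl-w1 g4, p649850 ACCEPTED `Theorems/…ExtinctIdentity.lean` (bodies verbatim; proof = dyadic cutoffs +
  -- the exact window identity `WindowIdentity.hasWindowIdentity_of_isEnergyConservative` (ns-ezl-w6 g2) + the final-window flux bound).
  Summit.NavierStokesRegularity.NavierStokesRegularity.Theorems.PowerGaugeEulerLiouville.ExtinctTrace.extinctIdentity

/-- STUB X3s [OPEN, PORT M/L — Seregin arXiv:2507.08733 pp. 5–6 verbatim]. -/
theorem stub_extinctSerrin : Sig.stub_extinctSerrin := by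
  sorry

/-- STUB X3r [OPEN residue, not claimed: the window `0 < ρ ≤ 2/9` outside Seregin's class]. -/
theorem stub_extinctSmallRhoRest : Sig.stub_extinctSmallRhoRest := by
  sorry

/-- REV2 refinement (kernel-checked): the re-cut X3s + X3r implies the old X3. -/
theorem stub_extinctSmallRho_of (h3s : Sig.stub_extinctSerrin) (h3r : Sig.stub_extinctSmallRhoRest) :
    Sig.stub_extinctSmallRho := by
  intro ρ hρ h29 u p H c hIn hX
  by_cases hS : MemSerrin ρ u
  · exact h3s ρ hρ (by linarith) u p H c hIn hX hS
  · exact h3r ρ hρ h29 u p H c hIn hX hS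

/-- STUB X4a [OPEN residue, not claimed: strictly dissipative members]. -/
theorem stub_dissipativeRest : Sig.stub_dissipativeRest := by
  sorry

/-- STUB X4b [OPEN residue = the core, not claimed: conservative members with persistent final energy]. -/
theorem stub_persistentRest : Sig.stub_persistentRest := by
  sorry

/-! ## Composition (kernel-checked): the five stubs imply the crux BY NAME -/

/-- `ρ > 1/2`: the landed `powerGaugeEulerLiouville_largeRho`; `0 < ρ ≤ 1/2`: split on the stratum — conservative ∧ extinct members
go to X2 (with (G2) `hasFinalWindowFluxBound_of_inClass`, for `2/9 < ρ`) or, for `ρ ≤ 2/9`, to X3s (Seregin's class) / X3r (the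
rest) via `stub_extinctSmallRho_of`; the complement to X4a / X4b. -/
theorem PowerGaugeEulerLiouville_of :
    Sig.stub_extinctIdentity → Sig.stub_extinctSerrin → Sig.stub_extinctSmallRhoRest → Sig.stub_dissipativeRest →
      Sig.stub_persistentRest →
      Summit.NavierStokesRegularity.NavierStokesRegularity.Theses.EulerZoomLiouville.PowerGaugeEulerLiouville := by
  intro h2 h3s h3r h4a h4b ρ hρ u p H c hsw hH hc
  have h3 : Sig.stub_extinctSmallRho := stub_extinctSmallRho_of h3s h3r
  by_cases hhalf : 1 / 2 < ρ
  · exact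
      Summit.NavierStokesRegularity.NavierStokesRegularity.Theorems.PowerGaugeEulerLiouville.powerGaugeEulerLiouville_largeRho
        ρ hhalf u p H c hsw hH hc
  · have hρ2 : ρ ≤ 1 / 2 := not_lt.mp hhalf
    have hIn : InClass ρ u p H c := ⟨hsw, hH, hc⟩
    by_cases hC : IsEnergyConservative u p
    · by_cases hX : IsEnergyExtinct u
      · by_cases h29 : 2 / 9 < ρ
        · exact h2 ρ h29 hρ2 u p H c hIn (hasFinalWindowFluxBound_of_inClass hρ.le hIn) ⟨hC, hX⟩
        · exact h3 ρ hρ (not_lt.mp h29) u p H c hIn ⟨hC, hX⟩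
      · exact h4b ρ hρ hρ2 u p H c hIn hC hX
    · exact h4a ρ hρ hρ2 u p H c hIn hC

/-! ## Sanity lemmas (kernel-checked, tiny): the stratum is not vacuous and not everything -/

/-- The zero field is energy-extinct. -/
theorem isEnergyExtinct_zero : IsEnergyExtinct (fun _ _ => (0 : E3)) := by
  intro a ha
  simp

/-- The zero field is in Seregin's class (any `ρ > −1`). -/
theorem memSerrin_zero {ρ : ℝ} (hρ : -1 < ρ) : MemSerrin ρ (fun _ _ => (0 : E3)) := by
  refine ⟨0, ae_of_all _ fun τ => ?_⟩
  have hq : (0 : ℝ) < 3 / (1 + ρ) := by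
    apply div_pos (by norm_num); linarith
  simp [ENNReal.zero_rpow_of_pos hq]

/-- Seregin's cubic-flux exponent is subunit on the whole window: `3(2−α)(α−1)/(2α−1) < 1` for `1 < α < 2` (p. 5). -/
theorem sereginFluxExponent_lt_one {α : ℝ} (h1 : 1 < α) (h2 : α < 2) :
    3 * (2 - α) * (α - 1) / (2 * α - 1) < 1 := by
  rw [div_lt_one (by linarith)]
  nlinarith [sq_nonneg (α - 4 / 3), sq_nonneg (α - 1)]

/-- The rate window of X2 is exactly `2/9 < ρ`: `1/2 − 9ρ/4 < 0 ↔ 2/9 < ρ`. -/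
theorem fluxExponent_neg_iff (ρ : ℝ) : 3 / 2 - 9 * ρ / 4 - 1 < 0 ↔ 2 / 9 < ρ := by
  constructor <;> intro h <;> linarith

end Summit.NavierStokesRegularity.NavierStokesRegularity.Cruxes.PowerGaugeEulerLiouville.ExtinctTrace
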